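import Summits.Schanuel.Schanuel.Theorems.RootDecomp1KHyper35
import Literature.Barriers.Schanuel.NesterenkoModularScopeMeasurePi
import Literature.NumberTheory.Transcendental.PiTranscendenceMeasure

/-!
# RootDecomp1KHyper — lens 6, generation 15 ADDENDA «EXP-LATTICE-ANCHORED CELL» (ExpAnchorT.lean v2 88910796…) and «NESTERENKO-ANCHORED CELL» (PiAnchorT.lean b5ead9a0…, §7) — continuation (RootDecomp1KHyper36): §7–§7c (lens-6 g15 ADDENDUM 2 «NESTERENKO-ANCHORED CELL», PiAnchorT.lean b5ead9a0…, ll. 2343–2588): `sb_three_of_latAnchorW`, transport of LNM 1752 Ch. 3 Cor. 5.2 to an `MvWeakMeasure` (`mvWeakMeasure_of_expT4`, `MvWeakMeasure.comp_injective`), Nesterenko's measured pair `θπ = (e^{π}, π)` (`mvWeakMeasure_θπ` mod h52), the lattice bound `latLB_int_pi` / `latLB_one_pi` (mod hNW = NW Thm 2(2) at degree one)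

(lens-6 g15 addenda: `ExpAnchorT.lean` v2 88910796…cc8b = parts 28–35, `PiAnchorT.lean` b5ead9a0…03de §7 (ll. 2343–2876; parts A–H byte-identical to ExpAnchorT) = parts 36–37; farm rc 0 · 0 sorry · axioms std; port by census-1 gen 14,
CENSUS-REQUESTs STATUS L1561 / L1583, critic PORT GO L1568 (e) / L1588 (e); import `RootDecomp1KHyper26` (+ `Literature.Barriers.Schanuel.NesterenkoModularScopeMeasurePi`, `Literature.NumberTheory.Transcendental.PiTranscendenceMeasure` from part 36 on), the source's g15 plane-lemma copy dropped,
sub-namespace `…HyperCell.LatCell`; statements and proofs verbatim (docstrings added, generic one-liners privatised, the two lint fixes of L1588 (a) in §7c); `hLW : LWMeasure`, `h52`, `hNW` (tree-named facts) stay binders; `--supports stmt-Schanuel-33363` (residual of record n = 3 := UnanchoredResidual₃″). Nothing here proves Schanuel; rung 0.)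
-/

noncomputable section

open Complex IntermediateField Polynomial

namespace Summit.Schanuel.Schanuel.Theorems.RootDecomp1KHyper

namespace HyperCell

namespace LatCell

variable {n : ℕ}
open Summit.Schanuel.Schanuel.Theorems.RootDecomp1KGeneric (HasHLPairInSpan Rank3SpanResidual
  mem_adjoin_of_mem_span cexp_mem_adjoin_of_mem_span)

/-! ## §7  BEYOND LINDEMANN–WEIERSTRASS: the NESTERENKO-ANCHORED cell `span_ℤ(z) ∋ N₁, π`

The critic's class M2 (VERDICT L1568 (b)/(d)): spans with NO Lindemann–Weierstrass anchor pair — e.g.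
`(1, x, y)` with `x` outside every LW field — "lever necessarily beyond Ably LW".  Here `x = π`.
The measured pair is Nesterenko's `θ_π = (e^{π}, π)`: algebraically independent WITH A MEASURE of
algebraic independence (LNM 1752 Ch. 3 Cor. 5.2; tree NAMED FACT
`Literature.Barriers.Schanuel.NesterenkoPhilippon2001_ch3_cor_5_2`, whose `{π, e^{π}, Γ(1/4)}` clause
is PROVED in the tree: `NesterenkoPhilippon2001_ch3_cor_5_2_pi_of`).  That measure is sub-exponential
(`exp(−μ T⁴ log²⁴ T)`), not polynomial — but the §1 engine only ever needed an `MvWeakMeasure`; the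
one place a POLYNOMIAL bound is used (Lemma L inside the extraction `hyperLatApprox_of_anchor`, via
`LatLB N₁ π`) is served by the transcendence measure of `π` AT DEGREE ONE (tree NAMED FACT
`Literature.NumberTheory.Transcendental.NesterenkoWaldschmidt1996_thm_2_2`, which at `d = 1` reads
`|U + Vπ| ≥ L^{−2·10⁶}`).  Result: the cell `HasPiIntAnchor z` (`span_ℤ(z) ∋ N₁ ≠ 0` and `∋ π`) is
DECIDED (mod those two named facts), the literal cell `(1, π, y)`, ANY `y`, with it; the explicit member
`z_π = (1, π − 3, y(π − 3))` needs ONLY Cor. 5.2 (no LW input anywhere in this section).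
-/

/-- The cell engine run with a WEAK (sub-exponential) measure on `θ`, the lattice lower bound being
supplied separately. -/
theorem sb_three_of_latAnchorW {z : Fin 3 → ℂ} (hz : LinearIndependent ℚ z)
    (hH : HyperLinLiouville z) {θ : Fin 2 → ℂ} (hθ : MvWeakMeasure θ)
    (hθz : ∀ i, θ i ∈ adjoin ℚ (SFset z ∪ {I})) (W₁ W₂ : MvPolynomial (Fin 2) ℤ)
    {w₁ w₂ : ℂ} (hw₁ : MvPolynomial.aeval θ W₁ = w₁) (hw₂ : MvPolynomial.aeval θ W₂ = w₂)
    (hLB : LatLB w₁ w₂)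
    (h₁ : w₁ ∈ Submodule.span ℤ (Set.range z)) (h₂ : w₂ ∈ Submodule.span ℤ (Set.range z)) :
    SB 3 z := by
  obtain ⟨a, ha⟩ := (Submodule.mem_span_range_iff_exists_fun ℤ).mp h₁
  obtain ⟨b, hb⟩ := (Submodule.mem_span_range_iff_exists_fun ℤ).mp h₂
  simp only [zsmul_eq_mul] at ha hb
  obtain ⟨j, hj⟩ := exists_cvec_ne_zeroL hLB ha hb
  have hy := hyperLatApprox_of_anchor hz hH hLB ha hb hj
  rw [← hw₁, ← hw₂] at hy
  exact sb_of_hyperLat_of_mvWeakMeasure (n := 2) hθ hθz W₁ W₂ hy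
    (mem_adjoin_SFset_I' (Or.inl ⟨j, rfl⟩))

/-! ### §7a  From the shape of LNM 1752 Ch. 3 Cor. 5.2 to an `MvWeakMeasure`; restriction to sub-tuples -/

/-- The maximum coefficient of an integer polynomial is at most its length. -/
private theorem natAbs_sup_le_mvlen {n : ℕ} (A : MvPolynomial (Fin n) ℤ) :
    (((A.support.sup fun m => (A.coeff m).natAbs : ℕ) : ℤ)) ≤ mvlen A := by
  have h1 : (A.support.sup fun m => (A.coeff m).natAbs) ≤ ∑ m ∈ A.support, (A.coeff m).natAbs :=
    Finset.sup_le fun m hm =>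
      Finset.single_le_sum (f := fun m => (A.coeff m).natAbs) (fun _ _ => Nat.zero_le _) hm
  have h2 : ((∑ m ∈ A.support, (A.coeff m).natAbs : ℕ) : ℤ) = mvlen A := by
    simp only [mvlen, Nat.cast_sum, Int.natCast_natAbs]
  rw [← h2]
  exact_mod_cast h1

/-- **A measure of the shape `|A(ξ)| ≥ exp(−μ T⁴ (log T)²⁴)` for all `T ≥ max(H(A) + deg A, e)`
(LNM 1752 Ch. 3 Cor. 5.2) is an `MvWeakMeasure`** (`C_d = μ (d + 4)²⁸`, exponent `28`). -/
theorem mvWeakMeasure_of_expT4 {n : ℕ} {ξ : Fin n → ℂ} {μ : ℝ} (hμ : 0 < μ)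
    (h : ∀ A : MvPolynomial (Fin n) ℤ, A ≠ 0 → ∀ T : ℝ,
      max (((A.support.sup fun m => (A.coeff m).natAbs : ℕ) : ℝ) + (A.totalDegree : ℝ))
          (Real.exp 1) ≤ T →
        Real.exp (-(μ * T ^ 4 * Real.log T ^ 24)) ≤ ‖MvPolynomial.aeval ξ A‖) :
    MvWeakMeasure ξ := by
  intro d
  refine ⟨μ * ((d : ℝ) + 4) ^ 28, 28, by positivity, fun P hP hdeg => ?_⟩
  have hd0 : (0 : ℝ) ≤ d := Nat.cast_nonneg d
  have hL1 : (1 : ℝ) ≤ ((mvlen P : ℤ) : ℝ) := by exact_mod_cast one_le_mvlen hP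
  have hH : (((P.support.sup fun m => (P.coeff m).natAbs : ℕ) : ℝ)) ≤ ((mvlen P : ℤ) : ℝ) := by
    have h1 := natAbs_sup_le_mvlen P
    have h2 : ((((P.support.sup fun m => (P.coeff m).natAbs : ℕ) : ℤ) : ℝ)) ≤
        ((mvlen P : ℤ) : ℝ) := by exact_mod_cast h1
    simpa using h2
  have hdeg' : (P.totalDegree : ℝ) ≤ d := by exact_mod_cast hdeg
  set T : ℝ := ((mvlen P : ℤ) : ℝ) + d + 3 with hT
  have he3 : Real.exp 1 < 3 := lt_trans Real.exp_one_lt_d9 (by norm_num)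
  have he : Real.exp 1 ≤ T := by rw [hT]; linarith
  have h1 := h P hP T (max_le (by rw [hT]; linarith) he)
  refine le_trans (Real.exp_le_exp.mpr (neg_le_neg ?_)) h1
  have hT1 : (1 : ℝ) ≤ T := by rw [hT]; linarith
  have hT0 : (0 : ℝ) < T := by linarith
  have hlog0 : 0 ≤ Real.log T := Real.log_nonneg hT1
  have hlogT : Real.log T ≤ T := (Real.log_le_sub_one_of_pos hT0).trans (by linarith)
  have hTL : T ≤ ((d : ℝ) + 4) * ((mvlen P : ℤ) : ℝ) := by rw [hT]; nlinarith
  calc μ * T ^ 4 * Real.log T ^ 24 ≤ μ * T ^ 4 * T ^ 24 := by gcongr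
    _ = μ * T ^ 28 := by ring
    _ ≤ μ * (((d : ℝ) + 4) * ((mvlen P : ℤ) : ℝ)) ^ 28 := by gcongr
    _ = μ * ((d : ℝ) + 4) ^ 28 * ((mvlen P : ℤ) : ℝ) ^ 28 := by ring

/-- The length is invariant under an injective renaming of the variables. -/
private theorem mvlen_rename_of_injective {n m : ℕ} {f : Fin n → Fin m} (hf : Function.Injective f)
    (P : MvPolynomial (Fin n) ℤ) : mvlen (MvPolynomial.rename f P) = mvlen P := by
  unfold mvlen
  rw [MvPolynomial.support_rename_of_injective hf,
    Finset.sum_image fun x _ y _ hxy => Finsupp.mapDomain_injective hf hxy]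
  refine Finset.sum_congr rfl fun d _ => ?_
  rw [MvPolynomial.coeff_rename_mapDomain f hf]

/-- **An `MvWeakMeasure` restricts to sub-tuples** (injective re-indexing). -/
theorem MvWeakMeasure.comp_injective {n m : ℕ} {ξ : Fin m → ℂ} (hξ : MvWeakMeasure ξ)
    {f : Fin n → Fin m} (hf : Function.Injective f) : MvWeakMeasure (ξ ∘ f) := by
  intro d
  obtain ⟨C, k, hC, h⟩ := hξ d
  refine ⟨C, k, hC, fun P hP hdeg => ?_⟩
  have hP' : MvPolynomial.rename f P ≠ 0 :=
    ((MvPolynomial.rename_injective f hf).ne_iff' (map_zero _)).mpr hP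
  have h1 := h (MvPolynomial.rename f P) hP' ((MvPolynomial.totalDegree_rename_le f P).trans hdeg)
  rwa [mvlen_rename_of_injective hf, MvPolynomial.aeval_rename] at h1

/-! ### §7b  Nesterenko's measured pair `θ_π = (e^{π}, π)` -/

/-- Nesterenko's pair, ordered `θ_π = (e^{π}, π)` (the anchor line `π` is `θ_π 1`). -/
def θπ : Fin 2 → ℂ := ![cexp (Real.pi : ℂ), (Real.pi : ℂ)]

/-- Coordinate `0` of Nesterenko's measured pair `θ_π = (e^{π}, π)`. -/
@[simp] theorem θπ_zero : θπ 0 = cexp (Real.pi : ℂ) := rfl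
/-- Coordinate `1` of Nesterenko's measured pair `θ_π = (e^{π}, π)`. -/
@[simp] theorem θπ_one : θπ 1 = (Real.pi : ℂ) := rfl

/-- `θ_π` is the restriction of the triple `(π, e^{π}, Γ(1/4))` along the injective re-indexing `Fin.castSucc ∘ Fin.rev` (used to transport Nesterenko's measure to the pair). -/
theorem θπ_eq_comp :
    θπ = (![(Real.pi : ℂ), cexp (Real.pi : ℂ), (Real.Gamma (1 / 4) : ℂ)] : Fin 3 → ℂ) ∘
      (Fin.castSucc ∘ Fin.rev) := by
  funext i
  match i with
  | 0 => rfl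
  | 1 => rfl

/-- **`θ_π = (e^{π}, π)` carries an `MvWeakMeasure`** (mod LNM 1752 Ch. 3 Cor. 5.2, whose `{π, e^π, Γ(1/4)}`
clause is tree-proved from the general statement; restrict to polynomials not involving `Γ(1/4)`). -/
theorem mvWeakMeasure_θπ (h52 : Literature.Barriers.Schanuel.NesterenkoPhilippon2001_ch3_cor_5_2) :
    MvWeakMeasure θπ := by
  obtain ⟨μ, hμ, h⟩ := Literature.Barriers.Schanuel.NesterenkoPhilippon2001_ch3_cor_5_2_pi_of h52
  rw [θπ_eq_comp]
  exact MvWeakMeasure.comp_injective (mvWeakMeasure_of_expT4 hμ h)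
    ((Fin.castSucc_injective 2).comp Fin.rev_injective)

/-- `(y, e^{π}, π)` is algebraically independent for `y` hyper-approximable from an affine lattice
`ℤ W₁(θ_π) + ℤ W₂(θ_π)` (mod Cor. 5.2) — the §1 engine at Nesterenko's pair. -/
theorem algebraicIndependent_option_θπ
    (h52 : Literature.Barriers.Schanuel.NesterenkoPhilippon2001_ch3_cor_5_2)
    (W₁ W₂ : MvPolynomial (Fin 2) ℤ) {y : ℂ}
    (hy : HyperLatApprox (MvPolynomial.aeval θπ W₁) (MvPolynomial.aeval θπ W₂) y) :
    AlgebraicIndependent ℚ (fun o : Option (Fin 2) => o.elim y θπ) :=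
  algebraicIndependent_option_of_mvWeakMeasure_hyperLat (mvWeakMeasure_θπ h52) W₁ W₂ hy

/-! ### §7c  The lattice bound `LatLB N₁ π` = the transcendence measure of `π` at degree one -/

/-- **`LatLB N₁ π`** (`N₁ ∈ ℤ ∖ 0`): `1 ≤ (3 + |N₁|)^{2·10⁶} (1 + |U| + |V|)^{2·10⁶} |U N₁ + V π|` for
`(U, V) ≠ 0` — Nesterenko–Waldschmidt 1996 Thm 2(2) at `d = 1`, `P = V x + U N₁`, `L = |U||N₁| + |V| + 3`. -/
theorem latLB_int_pi (hNW : Literature.NumberTheory.Transcendental.NesterenkoWaldschmidt1996_thm_2_2)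
    {N₁ : ℤ} (hN₁ : N₁ ≠ 0) : LatLB (N₁ : ℂ) (Real.pi : ℂ) := by
  refine ⟨(3 + |(N₁ : ℝ)|) ^ (2 * 10 ^ 6), 2 * 10 ^ 6, by positivity, fun U V hUV => ?_⟩
  set P : Polynomial ℤ := Polynomial.C V * Polynomial.X + Polynomial.C (U * N₁) with hPdef
  have hc0 : P.coeff 0 = U * N₁ := by
    rw [hPdef, Polynomial.coeff_add, Polynomial.coeff_C_mul, Polynomial.coeff_X_zero, mul_zero,
      zero_add, Polynomial.coeff_C_zero]
  have hc1 : P.coeff 1 = V := by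
    rw [hPdef, Polynomial.coeff_add, Polynomial.coeff_C_mul, Polynomial.coeff_X_one, mul_one,
      Polynomial.coeff_C_of_ne_zero one_ne_zero, add_zero]
  have hP0 : P ≠ 0 := by
    intro h0
    rw [h0, Polynomial.coeff_zero] at hc0 hc1
    rcases hUV with hU | hV
    · rcases mul_eq_zero.mp hc0.symm with h | h
      · exact hU h
      · exact hN₁ h
    · exact hV hc1.symm
  have hdeg : P.natDegree ≤ 1 := by rw [hPdef]; exact Polynomial.natDegree_linear_le
  obtain ⟨L, hL⟩ : ∃ L : ℕ, (L : ℤ) = |U| * |N₁| + |V| + 3 :=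
    ⟨(|U| * |N₁| + |V| + 3).toNat, Int.toNat_of_nonneg (by positivity)⟩
  have hlen : (∑ k ∈ Finset.range (P.natDegree + 1), |P.coeff k|) ≤ (L : ℤ) := by
    have hsub : Finset.range (P.natDegree + 1) ⊆ Finset.range 2 := fun x hx =>
      Finset.mem_range.mpr (lt_of_lt_of_le (Finset.mem_range.mp hx) (by omega))
    calc (∑ k ∈ Finset.range (P.natDegree + 1), |P.coeff k|)
        ≤ ∑ k ∈ Finset.range 2, |P.coeff k| :=
          Finset.sum_le_sum_of_subset_of_nonneg hsub fun _ _ _ => abs_nonneg _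
      _ = |U * N₁| + |V| := by simp [Finset.sum_range_succ, hc0, hc1]
      _ ≤ (L : ℤ) := by rw [hL, abs_mul]; linarith
  have h3L : 3 ≤ L := by
    have h1 : (3 : ℤ) ≤ L := by
      rw [hL]; nlinarith [abs_nonneg U, abs_nonneg N₁, abs_nonneg V]
    exact_mod_cast h1
  have hLpos : (0 : ℝ) < L := by exact_mod_cast (show 0 < L by omega)
  have haev : Polynomial.aeval (Real.pi : ℂ) P = (U : ℂ) * (N₁ : ℂ) + (V : ℂ) * (Real.pi : ℂ) := by
    simp only [hPdef, map_add, map_mul, Polynomial.aeval_C, Polynomial.aeval_X, algebraMap_int_eq,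
      Int.coe_castRingHom]
    ring
  have h1 := hNW P 1 L hP0 le_rfl hdeg hlen h3L
  rw [haev] at h1
  have h1' : Real.exp (-(2 * 10 ^ 6 * Real.log L)) ≤
      ‖(U : ℂ) * (N₁ : ℂ) + (V : ℂ) * (Real.pi : ℂ)‖ := by
    simpa using h1
  have hk : Real.exp (2 * 10 ^ 6 * Real.log L) = (L : ℝ) ^ (2 * 10 ^ 6) := by
    rw [show (2 * 10 ^ 6 : ℝ) * Real.log L = ((2 * 10 ^ 6 : ℕ) : ℝ) * Real.log L by push_cast; ring,
      Real.exp_nat_mul, Real.exp_log hLpos]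
  have h2 : (1 : ℝ) ≤ (L : ℝ) ^ (2 * 10 ^ 6) * ‖(U : ℂ) * (N₁ : ℂ) + (V : ℂ) * (Real.pi : ℂ)‖ :=
    calc (1 : ℝ) = (L : ℝ) ^ (2 * 10 ^ 6) * Real.exp (-(2 * 10 ^ 6 * Real.log L)) := by
          rw [Real.exp_neg, ← hk, mul_inv_cancel₀ (Real.exp_pos _).ne']
      _ ≤ (L : ℝ) ^ (2 * 10 ^ 6) * ‖(U : ℂ) * (N₁ : ℂ) + (V : ℂ) * (Real.pi : ℂ)‖ := by
          gcongr
  have hLle : (L : ℝ) ≤ (3 + |(N₁ : ℝ)|) * (1 + |(U : ℝ)| + |(V : ℝ)|) := by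
    have hLr : (L : ℝ) = |(U : ℝ)| * |(N₁ : ℝ)| + |(V : ℝ)| + 3 := by
      have h := congrArg (fun x : ℤ => (x : ℝ)) hL
      push_cast at h
      exact h
    rw [hLr]
    nlinarith [abs_nonneg (U : ℝ), abs_nonneg (N₁ : ℝ), abs_nonneg (V : ℝ),
      mul_nonneg (abs_nonneg (U : ℝ)) (abs_nonneg (N₁ : ℝ)),
      mul_nonneg (abs_nonneg (V : ℝ)) (abs_nonneg (N₁ : ℝ))]
  have hpow : (L : ℝ) ^ (2 * 10 ^ 6) ≤
      (3 + |(N₁ : ℝ)|) ^ (2 * 10 ^ 6) * (1 + |(U : ℝ)| + |(V : ℝ)|) ^ (2 * 10 ^ 6) := by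
    rw [← mul_pow]
    exact pow_le_pow_left₀ (Nat.cast_nonneg L) hLle _
  calc (1 : ℝ) ≤ (L : ℝ) ^ (2 * 10 ^ 6) * ‖(U : ℂ) * (N₁ : ℂ) + (V : ℂ) * (Real.pi : ℂ)‖ := h2
    _ ≤ (3 + |(N₁ : ℝ)|) ^ (2 * 10 ^ 6) * (1 + |(U : ℝ)| + |(V : ℝ)|) ^ (2 * 10 ^ 6) *
          ‖(U : ℂ) * (N₁ : ℂ) + (V : ℂ) * (Real.pi : ℂ)‖ := by
        gcongr

/-- `LatLB 1 π` (mod NW 1996 Thm 2(2)). -/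
theorem latLB_one_pi (hNW : Literature.NumberTheory.Transcendental.NesterenkoWaldschmidt1996_thm_2_2) :
    LatLB 1 (Real.pi : ℂ) := by
  have h := latLB_int_pi hNW (one_ne_zero (α := ℤ))
  rwa [Int.cast_one] at h

/-- Shifting the second lattice generator by an integer multiple of the first (`w ↦ w − k`) keeps
`LatLB 1 w`. -/
theorem LatLB.one_sub_int {w : ℂ} (h : LatLB 1 w) (k : ℤ) : LatLB 1 (w - k) := by
  obtain ⟨C, τ, hC, hall⟩ := h
  refine ⟨C * (1 + |(k : ℝ)|) ^ τ, τ, by positivity, fun U V hUV => ?_⟩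
  have hUV' : U - k * V ≠ 0 ∨ V ≠ 0 := by
    by_cases hV : V = 0
    · left
      rw [hV, mul_zero, sub_zero]
      rcases hUV with hU | hV'
      · exact hU
      · exact absurd hV hV'
    · exact Or.inr hV
  have h1 := hall (U - k * V) V hUV'
  have e : ((U - k * V : ℤ) : ℂ) * 1 + (V : ℂ) * w = (U : ℂ) * 1 + (V : ℂ) * (w - k) := by
    push_cast; ring
  rw [e] at h1
  have hb : (1 : ℝ) + |((U - k * V : ℤ) : ℝ)| + |(V : ℝ)| ≤
      (1 + |(k : ℝ)|) * (1 + |(U : ℝ)| + |(V : ℝ)|) := by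
    have ht := abs_add_le (U : ℝ) (-((k : ℝ) * V))
    rw [← sub_eq_add_neg, abs_neg, abs_mul] at ht
    push_cast
    nlinarith [abs_nonneg (U : ℝ), abs_nonneg (V : ℝ), abs_nonneg (k : ℝ),
      mul_nonneg (abs_nonneg (k : ℝ)) (abs_nonneg (U : ℝ)),
      mul_nonneg (abs_nonneg (k : ℝ)) (abs_nonneg (V : ℝ))]
  calc (1 : ℝ) ≤ C * (1 + |((U - k * V : ℤ) : ℝ)| + |(V : ℝ)|) ^ τ *
        ‖(U : ℂ) * 1 + (V : ℂ) * (w - k)‖ := h1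
    _ ≤ C * ((1 + |(k : ℝ)|) * (1 + |(U : ℝ)| + |(V : ℝ)|)) ^ τ *
        ‖(U : ℂ) * 1 + (V : ℂ) * (w - k)‖ := by gcongr
    _ = C * (1 + |(k : ℝ)|) ^ τ * (1 + |(U : ℝ)| + |(V : ℝ)|) ^ τ *
        ‖(U : ℂ) * 1 + (V : ℂ) * (w - k)‖ := by rw [mul_pow]; ring

end LatCell

end HyperCell

end Summit.Schanuel.Schanuel.Theorems.RootDecomp1KHyper
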